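import Mathlib.Data.Set.Finite.List
import Literature.Computability.MetaComplexity.OneSidedHeuristics
import Literature.Computability.MetaComplexity.GapMINKT
import Literature.Computability.Complexity.CoinCounting
import HarnessLib

/-!
# Complexity meta: `Gap(K vs K)` and algorithmic language compression (Hirahara 2021, §2, §4, Lemma 5.1)

Topic `Literature/Computability/MetaComplexity`, companion to `UniversalMachine.lean` (`K^t`,
`MINKT`), `GapMINKT.lean` (Hirahara 2018's `Gap_{σ,τ} MINKT`), `OneSidedHeuristics.lean`
(`Avg¹_δ P`, the tally ensemble) and `SearchHeuristicSchemes.lean` (the named fact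
`Hirahara2021_UP_searchUHS_of_Avg1P` = Thm. 8.9 of the paper for `UP`-type verifiers) for
S. Hirahara, *Average-case hardness of NP from exponential worst-case hardness assumptions*,
STOC 2021, full version ECCC TR21-058 (numbering cited). The proof of Thm. 8.9 (a universal
heuristic scheme for the search version of `NP_sv`, hence for `UP`) rests on five results of
§3–§5 of the paper, all under the hypothesis `coNP × {U, T} ⊆ Avg¹_{1-n^{-c}} P`. This file vendors
two of them as named facts (statement only, `def … : Prop`, D-0014), with their vocabulary:

* Def. 2.5 — `UniversalMachine.gapKvsK τ`, the promise problem `Gap_τ(K vs K)` (oracle `A = ∅`):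
  yes-instances `⟨x, 1ᵗ, 1ˢ⟩` with `K^t(x) ≤ s`, no-instances with
  `K^{τ(|x|+t)}(x) > s + log τ(|x|+t)`;
* **Lemma 5.1** (`Hirahara2021_gapKvsK_mem_PromiseP`): the hypothesis implies
  `Gap(K vs K) ∈ pr-P`, i.e. `Gap_τ(K vs K) ∈ pr-P` for some polynomial `τ`;
* Def. 4.1 — `languageSlice L t = L_t = {x | (x, 1ᵗ) ∈ L}` and `IsLanguageEnsemble L`
  (`|x| ≤ p_L(t)` on `L_t`), `UniversalMachine.compressionProblem` (the promise problem of Thm. 4.2);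
* **Thm. 4.2, algorithmic language compression** (`Hirahara2021_languageCompression`): for an
  ensemble of languages `L ∈ NP`, under the hypothesis there is a polynomial `p` such that
  `(Π_Yes := L, Π_No := {(x, 1ᵗ) | K^{p(t)}(x) > log |L_t| + log p(t)}) ∈ pr-P`; and its printed
  corollary **Cor. 4.4 (language compression)**, PROVED from the fact
  (`Hirahara2021_languageCompression.ktAt_le`).

The remaining three ingredients are not vendored as named facts: they enter the formalised proof of
Thm. 8.9 (`UPSearchAssembly.lean`, `Hirahara2021_UP_searchUHS_of_Avg1P_of`) as its explicit
hypotheses `h34` (Lemma 3.4, the Buhrman–Fortnow–Pavan pseudorandom generator, in the promise form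
`pr-BPP = pr-P`), `h312` (Thm. 3.12, reconstruction for the `k`-wise direct product generator,
enumeration form, over the vocabulary of §3.3 fixed in `DirectProductGenerator.lean`) and `h52`,
**Thm. 5.2, weak symmetry of information** in its printed form (*under the hypothesis there are
polynomials `p₀, p_w` with `Pr_{w ← {0,1}^m}[K^t(xw) ≥ K^{p_w(t/ε)}(x) + m - log p_w(t/ε)] ≥ 1 - ε`
for all `n, m`, `t ≥ p₀(nm)`, `ε > 0`, `x ∈ {0,1}ⁿ`*, p. 30). Thm. 5.2 was a named fact of this file
(`Hirahara2021_weakSymmetryOfInformation`, p25221) until the D-0026 review of its decomposition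
(2026-08-15) merged it back into the proof obligation of Thm. 8.9: its one-page printed proof
invokes Lemma 5.1 (the sibling fact below) and Thm. 3.12 in its Kolmogorov form
`K^{p(ns/ε)}(x | D) ≤ k + log p(ns/ε)` for the *randomised* distinguisher
`D(ω; w) := A(ω·w, 1^{2t}, 1ˢ)` — a corollary of Thm. 3.12 (resting on Lemma 3.4) that the tree
does not have and that the enumeration form cannot replace (fixing `w` by averaging puts `m` bits
into the description of `x`, and an enumeration in time `poly(2^k)` is not a polynomial budget for
`k ≈ K(x)`) —, so the closed fact was not dischargeable apart from its sibling and that theory, and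
decompositions do not recurse (see `UPSearchAssembly.lean`, "Size of what remains", for the proof
plan of the relative statement). The conventions fixed for it are kept below for the inline
hypothesis (`ε = 1/e`, `t/ε = t·e`, success form; `UniversalMachine.weakSOI_failure_le` in
`UPSearchAssembly.lean` gives the failure form consumed by the scheme).

## Conventions (faithfulness)

* `∀ U : UniversalMachine` as everywhere in the topic (the statements are robust under polynomial
  simulation overhead, absorbed by the existential polynomials).
* The hypothesis `coNP × {U, T} ⊆ Avg¹_{1-n^{-c}} P` for some constant `c` is written exactly as in
  `Hirahara2021_UP_hasUHS_of_Avg1P`: `∃ c, distClass coNP {uniformEnsemble, tallyEnsemble} ⊆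
  Avg1DeltaP fun n => 1 - 1 / (n : ℝ) ^ c`.
* `log` is the binary logarithm; thresholds `K > s + log τ` with integer `K, s` are rendered with
  `Nat.log 2` (floor), which is *equivalent* for a single logarithm (`K > s + log τ ↔ K > s + ⌊log τ⌋`
  for integers `K, s`) and, for the sum of two logarithms in Thm. 4.2 (resp. the real logarithm of
  Thm. 5.2), equivalent up to replacing the existential polynomial `p` by `4p` (resp. `p_w` by `2p_w`:
  `⌊log a⌋ + ⌊log 4p⌋ ≥ log a + log p`, `⌈log p_w⌉ ≤ ⌊log 2p_w⌋`, `K^{4p(t)} ≤ K^{p(t)}`), so the vendored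
  sentences are implied by the printed ones.
* `K^t` is `ℕ∞`-valued (`UniversalMachine.ktAt`); all inequalities are stated in `ℕ∞` without
  subtraction (`K^{t'}(x) + m ≤ K^t(xw) + log p_w` for `K^t(xw) ≥ K^{t'}(x) + m - log p_w`).
* Thm. 5.2's real `ε > 0` enters only through `1/ε` inside a polynomial and as the failure bound; it
  is rendered as `ε = 1/e` for a positive integer `e` (for `1/(e+1) < ε ≤ 1/e` use `e + 1` and the
  polynomial `p_w(2u)`; `ε > 1` is vacuous), `t/ε = t·e`.
* `pr-P` is `PromiseP = promiseLift P` (`Promise.lean`); `(x, 1ᵗ)` is `paramEnc (x, t)`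
  (`DistProblems.lean`); triples `⟨x, 1ᵗ, 1ˢ⟩` are encoded as in `U.MINKT`.

Mathlib has no Kolmogorov complexity, promise classes or average-case classes; nothing is
duplicated (`lean search` "language compression", "symmetry of information", "GapMINKT": only the
anchors imported here; `GapMINKT.lean`'s `gapMINKT σ τ` cannot express Def. 2.5, whose size
threshold `s + log τ(|x| + t)` depends on `t`).

## D-0026 bad-split review of `Hirahara2021_languageCompression` (2026-08-15)

The fact was re-checked against ECCC TR21-058, p. 26 (Thm. 4.2, Remark 4.3, Cor. 4.4): it is the
`A = ∅` instance of the printed theorem, weaker than print only through the conventions above; not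
mis-stated, not an open problem (proved on pp. 27–29), a distinct published result with its own
locator, consumed (as `h42`) in `UPSearchAssembly.lean`, `UniversalHeuristicSchemesBFPProofs.lean`
and `Cryptography/AverageCaseProofs.lean`. Verdict: **kept as a named fact; honestly XL; not
provable inline from the tree; not restated or merged.** What its printed proof needs, besides
`L' ∈ NP` (p. 28) and Claim 4.7:

* Lemma 3.4 (p. 20): a pseudorandom generator `G_n : {0,1}^{O(log n)} → {0,1}^n` computable in
  polynomial time and secure against linear-size circuits, from the hypothesis (BCGL92 `NE = E`,
  KS04 `pr-MA = pr-NP`, BFP05 `E ⊄ i.o.SIZE(2^{εn})`, IW97). The tree has no generator from this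
  hypothesis: `Complexity.impagliazzo_wigderson` (`CircuitLowerBounds.lean`) concludes only
  `P = BPP`, and `BuhrmanFortnowPavan2004_PromiseBPP'_subset_PromiseP`
  (`AvgCaseDerandomization.lean`) assumes `DistNP ⊆ AvgP` and concludes only
  `PromiseBPP' ⊆ PromiseP`.
* Lemma 3.6 (p. 21, parameterised uniform distributions): its proof pads the instance with outputs
  of that generator (pad length `⟨p(n), q(n)⟩ - p(n)`); it is used for the distribution of
  `(DP_k(x; z), 1^{⟨n,t⟩})` (p. 28) and inside Lemma 4.5 (p. 27). The review found no generator-free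
  substitute under the weak hypothesis: a random pad makes the test of Claim 4.7 randomised, and the
  `K`-bound of Claim 4.7 (2) needs a test with an `O(log t)`-bit description; a prefix encoding of
  `(n, t)` is a slice of density `2^{-O(log)}` that a success probability `m^{-c}` may avoid; the
  instance length must be `≥ t` anyway (running time `poly(t)`), so the pad has length `Θ(t)`.
* Thm. 3.12 (pp. 23–25) in its `K`-form `K^{p(ns/ε)}(x | D) ≤ k + log p(ns/ε)`: the coins of the
  randomised reconstruction of Lemma 3.14 are fixed by two seeds of the same generator (p. 25). The
  *enumeration* form (the remark after Thm. 3.12; hypothesis `h312` of `UPSearchAssembly.lean`) does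
  **not** suffice for Thm. 4.2: it bounds `K` only at the time budget `poly(n · 2^k / ε)`, and
  `2^{k(t)} = Θ(|L_t| · t^d)` (p. 28) is super-polynomial in `t` whenever `|L_t|` is, whereas `Π_No`
  needs the budget `q(t)` polynomial in `t` (the `K`-form's budget does not depend on `2^k` because
  the short program runs the reconstruction once).
* Lemma 4.5 (pp. 26–28): `|L_t| ≤ v ≤ 4|L_t|` in polynomial time, from the Goldwasser–Sipser lower
  bound protocol (Lemma 4.6), Lemma 3.6 and `pr-BPP = pr-P`.

Recorded for the cone. (1) Lemma 5.1 and Thm. 5.2 are not independent of Thm. 4.2 (p. 29: Lemma 5.1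
is Thm. 4.2 applied to the `NP` ensemble `{x | K^t(x) ≤ s}` of size `≤ 2^{s+1}`; p. 30: Thm. 5.2
from Lemma 5.1 and Thm. 3.12), so Thm. 4.2, Lemma 3.4 and Thm. 3.12 are the pivotal leaves
(accordingly Thm. 5.2 is, since the same day's review of its own decomposition, the inline
hypothesis `h52` of the consumers and no longer a named fact of this file; see above).
(2) Under the *strong* hypothesis `DistNP ⊆ AvgP` of Lemma 2.2 (1) / Thm. 1.6 (1)
(`UniversalHeuristicSchemesBFPProofs.lean`, `Cryptography.hirahara_UP_DistNP_of_nonempty_of_BFP`)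
the two distributions above are polynomial-time samplable as they stand (the sampler outputs
`(w, 1^{⟨n,t⟩})` itself) and the tree's `AvgP` is the scheme class (failure `≤ 1/m` with `m` chosen
at run time), so Lemma 3.6 is not needed there and the generator survives only inside the `K`-form
of Thm. 3.12: the `DistNP ⊆ AvgP` form of Thm. 4.2 is provable, with no new named fact, relative to
`PromiseBPP' ⊆ PromiseP` and the `K`-form of Thm. 3.12 for polynomial-time tests with auxiliary
input — errorless scheme `A` for `L'`; Eq. (6); the
deterministic test `w ↦ [A(w; 1^{⟨n,t⟩}, 1^m) = 0]`, which never fires on `DP_k(x; z)` for `x ∈ L_t`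
and fires with probability `≥ 1 - t^{-d} - 1/m` on uniform `w`, so that acceptance probability
`≥ 1/2` of the sampler `B'` forces `dpAdvantage ≥ 1/4` and the `K`-bound; `B'` is one-sided (accepts
yes-instances with probability `1`, no-instances with probability `< 1/2`), hence in `PromiseBPP'`;
Lemma 4.5 with one pairwise-independent affine hash per sample (gap `|L_t| ≥ 2^K` against
`|L_t| ≤ 2^{K-5}`, probabilities `≥ 7/8` and `≤ 1/4`) — and the same route then gives Lemma 5.1 and
Thm. 5.2 in `DistNP ⊆ AvgP` form, i.e. the whole `DistNP`-level cone relative to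
`BuhrmanFortnowPavan2004_PromiseBPP'_subset_PromiseP`, the `K`-form of Thm. 3.12 and
`UniversalMachine.nonempty`. In that `K`-form the test must be allowed running time `poly(t)`,
which may be exponential in `|w| = (|x|+1)·k(t)` (no-instances `(x, 1ᵗ)` exist with `t` as large
as `2^{|x|/O(1)}`, by counting, Fact 3.7; for `t ≥ 2^{|x|+O(1)}` there are none once `p(t) ≥ t`,
by the `print` axiom), charged only for its `O(log t)`-bit description, as on p. 29
(`K^{q(t)}(x) ≤ k(t) + log q(t)`).
Verdict "not merged": folding the statement into the five `h42` binders of the three consumer files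
would pay no debt and lose a reviewed vendoring; "not restated": no printed statement weaker than
Thm. 4.2 serves `Hirahara2021_UP_searchUHS_of_Avg1P_of`, which lives at the weak hypothesis.

## Update (2026-08-15, later the same day): Thm. 4.2 PROVED relative to Lemma 3.4 and the `K`-form of Thm. 3.12

The inline proof plan recorded above has since been carried out WITHOUT new named facts:
**`Hirahara2021_languageCompression_of h34 h312K : Hirahara2021_languageCompression`**
(`LanguageCompressionFinal.lean`), where the two hypotheses are exactly the paper's two separate
§3 results — `h34`, Lemma 3.4 in promise form (`(∃ c, coNP × {U,T} ⊆ Avg¹_{1-n^{-c}}P) →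
PromiseBPP' ⊆ PromiseP`), and `h312K`, Thm. 3.12 in its `K^t`-form for polynomial-time tests with a
unary parameter (`∀ U, hyp → ∀ D₀ ∈ P, ∃ q, ∀ x m k e, 1 ≤ e →
1/e ≤ dpAdvantage k x (w ↦ [paramEnc (w, m) ∈ D₀]) → K^{q(|x|+k+e+m)}(x) ≤ k + log q(|x|+k+e+m)`).
Everything else of the printed proof (pp. 26–29) is a theorem of the tree:

* Lemma 3.6 — contrary to the review's expectation above, a **generator-free substitute** suffices
  and is proved (`ParamUniform.exists_heuristic_paramUniform`, `ParamUniformHeuristics.lean`, with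
  `ParamUniformPadding.lean` / `ParamUniformWitness.lean`): the instance `(r, 1^m)` is padded by
  uniformly random junk to an injective length, the resulting `coNP × {U}` problem is run through the
  hypothesis, and the junk is removed again inside a `pr-coRP` promise problem decided by
  `pr-BPP = pr-P` (`Complexity/PromiseRPAmplification.lean`); the heuristic so obtained is a
  deterministic polynomial-time test with an `O(1)`-size description plus the parameter, which is all
  Claim 4.7 (2) needs;
* `L' ∈ NP` and Eq. (6) (`LanguageCompressionNP.lean`), the test `B'` and its one-sidedness
  (`LanguageCompressionTest.lean`), Claim 4.7 (`LanguageCompressionClaim.lean`), the bounds and the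
  finite patching of small `t` (`LanguageCompressionBounds.lean`, `Complexity/FinitePatching.lean`),
  the assembly `LCAssembly.Hirahara2021_languageCompression_of_lemmas` (`LanguageCompressionAssembly.lean`);
* Lemma 4.5 with Lemma 4.6 — PROVED (`SLB.exists_logSizeEstimator`, `SliceEstimator.lean`, over
  `SliceLowerBoundVerifier.lean` / `SliceLowerBoundNP.lean` / `Complexity/HashHitBlocks.lean` /
  `Complexity/SetLowerBoundChernoff.lean`): the Goldwasser–Sipser lower bound protocol for the slices
  `L_t` with `u(t) = 128(t+1)` independent affine hashes and a Chernoff threshold (error `e^{-(t+1)}`,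
  Chebyshev being circular against the heuristic's success exponent), its `NP` verifier, the
  generator-free Lemma 3.6, block-disjunction amplification into `PromiseBPP'`, `pr-BPP = pr-P`, and
  an `FP` maximum loop over `κ ≤ p_L(t) + 2` (`|L_t| ≤ 2^{κ*} ≤ 8|L_t|`, the printed `v ≤ 4|L_t|` up to
  the rounding of `κ = ⌊log v⌋ + 1`).

What the discharge `Hirahara2021_languageCompression_holds` still needs is therefore exactly
Lemma 3.4 (whose published ingredients BFP05 Lemma 3.7 and KS04 are not in the tree; BCGL92
`NE = E` and IW97 are: `Hirahara2021_E_eq_NE_of_Avg1P`, `Hirahara2021_exists_certifier_of_Avg1P`,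
`Complexity.PromiseBPP'_subset_PromiseP_of_avgHard_E`) and the `K`-form of Thm. 3.12 (being
assembled in `DPHybrid.lean`, `DPReconstructionHybrid*.lean`, `DPReconstructionKCircuits.lean`,
`DPReconstructionKProgram.lean`; it takes the generator of Lemma 3.4 as a `Fools` hypothesis).

## References

* S. Hirahara, *Average-case hardness of NP from exponential worst-case hardness assumptions*,
  STOC 2021; full version ECCC TR21-058: Def. 2.5, Fact 3.7, Def. 4.1, Thm. 4.2, Remark 4.3,
  Cor. 4.4, Lemma 5.1, Thm. 5.2 (pp. 9, 22, 26, 29–30).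
* S. Hirahara, *Non-black-box worst-case to average-case reductions within NP*, FOCS 2018
  (`Gap MINKT`); *Unexpected hardness results for Kolmogorov complexity under uniform reductions*,
  STOC 2020; *Characterizing average-case complexity of PH by worst-case meta-complexity*, FOCS 2020
  (the sources of Lemma 5.1 cited in the paper).
* K.-I. Ko, *On the complexity of learning minimum time-bounded Turing machines*, SIAM J. Comput.
  20 (1991) (Def. 2.5 is "[Ko91, Hir20b]").
* A. K. Zvonkin, L. A. Levin, *The complexity of finite objects …*, Russian Math. Surveys 25 (1970),
  Thm. 5.2 (symmetry of information, the resource-unbounded statement).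
-/

namespace Literature.Computability.MetaComplexity

open _root_.Computability Complexity Complexity.Classes Complexity.Nondeterministic

namespace UniversalMachine

variable (U : UniversalMachine)

/-! ### Def. 2.5: `Gap_τ(K vs K)` -/

/-- **`Gap_τ(K vs K)`** (Hirahara 2021, Def. 2.5, with the empty oracle `A = ∅`, where
`Gap_τ(K^A vs K) = Gap_τ MINKT`): for `τ : ℕ → ℕ`, the promise problem with
`Π_Yes := {⟨x, 1ᵗ, 1ˢ⟩ | K^t(x) ≤ s}` (Ko's `MINKT`, `U.MINKT`) and
`Π_No := {⟨x, 1ᵗ, 1ˢ⟩ | K^{τ(|x|+t)}(x) > s + log τ(|x|+t)}`; triples are encoded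
`boolPair x (boolPair (unaryEncodeNat t) (unaryEncodeNat s))` as in `U.MINKT`, `log = Nat.log 2`
(equivalent to the real logarithm here, both sides being integers otherwise).
"`Gap(K vs K) ∈ pr-P`" means `Gap_τ(K vs K) ∈ pr-P` for some polynomial `τ`.
[Hirahara 2021 (ECCC TR21-058), Def. 2.5; Ko 1991] [cite: Hirahara2021, Def. 2.5] -/
def gapKvsK (τ : ℕ → ℕ) : PromiseProblem :=
  ⟨U.MINKT,
    {w | ∃ (x : List Bool) (t s : ℕ),
      w = boolPair x (boolPair (unaryEncodeNat t) (unaryEncodeNat s)) ∧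
        ((s + Nat.log 2 (τ (x.length + t)) : ℕ) : ℕ∞) < U.ktAt (τ (x.length + t)) x}⟩

/-- The yes-instances of `Gap_τ(K vs K)` are `MINKT` (by definition).
[Hirahara 2021 (ECCC TR21-058), Def. 2.5] [cite: Hirahara2021, Def. 2.5] -/
@[simp] theorem gapKvsK_yes (τ : ℕ → ℕ) : (U.gapKvsK τ).yes = U.MINKT := rfl

/-- A well-formed triple `⟨x, 1ᵗ, 1ˢ⟩` is a yes-instance of `Gap_τ(K vs K)` iff `K^t(x) ≤ s`.
[Hirahara 2021 (ECCC TR21-058), Def. 2.5] [cite: Hirahara2021, Def. 2.5] -/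
theorem boolPair_mem_gapKvsK_yes_iff (τ : ℕ → ℕ) {x : List Bool} {t s : ℕ} :
    boolPair x (boolPair (unaryEncodeNat t) (unaryEncodeNat s)) ∈ (U.gapKvsK τ).yes ↔
      U.ktAt t x ≤ s :=
  U.boolPair_mem_MINKT_iff

/-- A well-formed triple `⟨x, 1ᵗ, 1ˢ⟩` is a no-instance of `Gap_τ(K vs K)` iff
`s + log τ(|x|+t) < K^{τ(|x|+t)}(x)` (injectivity of `boolPair` and `unaryEncodeNat`).
[Hirahara 2021 (ECCC TR21-058), Def. 2.5] [cite: Hirahara2021, Def. 2.5] -/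
theorem boolPair_mem_gapKvsK_no_iff (τ : ℕ → ℕ) {x : List Bool} {t s : ℕ} :
    boolPair x (boolPair (unaryEncodeNat t) (unaryEncodeNat s)) ∈ (U.gapKvsK τ).no ↔
      ((s + Nat.log 2 (τ (x.length + t)) : ℕ) : ℕ∞) < U.ktAt (τ (x.length + t)) x := by
  constructor
  · rintro ⟨x', t', s', h, hk⟩
    have h1 := boolPair_injective (a₁ := (x, _)) (a₂ := (x', _)) h
    simp only [Prod.mk.injEq] at h1
    obtain ⟨rfl, h2⟩ := h1
    have h3 := boolPair_injective (a₁ := (unaryEncodeNat t, _)) (a₂ := (unaryEncodeNat t', _)) h2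
    simp only [Prod.mk.injEq] at h3
    obtain ⟨ht, hs⟩ := h3
    have ht' : t = t' := by simpa using congr_arg unaryDecodeNat ht
    have hs' : s = s' := by simpa using congr_arg unaryDecodeNat hs
    subst ht' hs'
    exact hk
  · exact fun h => ⟨x, t, s, rfl, h⟩

/-- If `τ(m) ≥ m` pointwise then `Gap_τ(K vs K)` is a genuine (disjoint) promise problem:
on a yes-instance `K^{τ(|x|+t)}(x) ≤ K^t(x) ≤ s ≤ s + log τ(|x|+t)` (antitonicity of `K^t`).
[Hirahara 2021 (ECCC TR21-058), Def. 2.5] [cite: Hirahara2021, Def. 2.5] -/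
theorem gapKvsK_disjoint {τ : ℕ → ℕ} (hτ : ∀ m, m ≤ τ m) : (U.gapKvsK τ).Disjoint := by
  refine Set.disjoint_left.2 ?_
  rintro w ⟨x, t, s, rfl, hyes⟩ hno
  have hno' := (U.boolPair_mem_gapKvsK_no_iff τ).1 hno
  have ht : t ≤ τ (x.length + t) := (Nat.le_add_left t x.length).trans (hτ _)
  have h : U.ktAt (τ (x.length + t)) x ≤ ((s + Nat.log 2 (τ (x.length + t)) : ℕ) : ℕ∞) :=
    (U.ktAt_anti ht x).trans (hyes.trans (by exact_mod_cast Nat.le_add_right s _))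
  exact absurd hno' (not_lt.mpr h)

/-- Enlarging `τ` shrinks the no-part of `Gap_τ(K vs K)`: if `τ ≤ τ'` pointwise then every
no-instance of `Gap_{τ'}(K vs K)` is a no-instance of `Gap_τ(K vs K)`
(`K^{τ'}(x) ≤ K^{τ}(x)` and `log τ ≤ log τ'`). [Hirahara 2021 (ECCC TR21-058), Def. 2.5]
[cite: Hirahara2021, Def. 2.5] -/
theorem gapKvsK_no_anti {τ τ' : ℕ → ℕ} (h : ∀ m, τ m ≤ τ' m) : (U.gapKvsK τ').no ≤ (U.gapKvsK τ).no := by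
  rintro w ⟨x, t, s, rfl, hk⟩
  refine ⟨x, t, s, rfl, lt_of_le_of_lt ?_ (hk.trans_le (U.ktAt_anti (h _) x))⟩
  exact_mod_cast Nat.add_le_add_left (Nat.log_mono_right (h _)) s

end UniversalMachine

/-- `pr-P` is antitone in the no-part for a fixed yes-part: a separating `P` language for
`(Y, N)` separates `(Y, N')` for every `N' ⊆ N`. [Goldreich 2006, Def. 1.2] [folklore] -/
theorem mem_PromiseP_of_no_subset {Q Q' : PromiseProblem} (hQ : Q ∈ PromiseP) (hyes : Q'.yes ≤ Q.yes)
    (hno : Q'.no ≤ Q.no) : Q' ∈ PromiseP := by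
  obtain ⟨L, hL, hy, hn⟩ := hQ
  exact ⟨L, hL, hyes.trans hy, hno.trans hn⟩

/-! ### Lemma 5.1: `Gap(K vs K) ∈ pr-P` from `coNP × {U, T} ⊆ Avg¹_{1-n^{-c}} P` (named fact) -/

/-- **Hirahara 2021, Lemma 5.1** (for the empty oracle; the paper's sources are [Hir20b, Hir20a]).
*For any oracle `A`, if `coNP^A × {U, T} ⊆ Avg¹_{1-n^{-c}} P` for some constant `c`, then
`Gap(K^A vs K) ∈ pr-P`*, i.e. `Gap_τ(K^A vs K) ∈ pr-P` for some polynomial `τ` (Def. 2.5).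
Vendored with `A = ∅` (`coNP^∅ = coNP`, `Gap_τ(K^∅ vs K) = U.gapKvsK τ`), which is the instance used
in the proofs of Thm. 5.2 and Thm. 8.9; printed proof: algorithmic language compression (Thm. 4.2)
applied to the `NP` ensemble `L_{⟨t,s⟩} := {x | K^t(x) ≤ s}` of size `≤ 2^{s+1}` (Fact 3.7).
Conventions: `∀ U : UniversalMachine`; the hypothesis is written as in
`Hirahara2021_UP_hasUHS_of_Avg1P`. [Hirahara 2021 (ECCC TR21-058), Lemma 5.1 with Def. 2.5]
[cite: Hirahara2021, Lemma 5.1] -/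
def Hirahara2021_gapKvsK_mem_PromiseP : Prop :=
  ∀ U : UniversalMachine,
    (∃ c : ℕ, distClass coNP {uniformEnsemble, tallyEnsemble} ⊆
      Avg1DeltaP fun n => 1 - 1 / (n : ℝ) ^ c) →
    ∃ τ : Polynomial ℕ, U.gapKvsK (fun m => τ.eval m) ∈ PromiseP

/-- **Lemma 5.1 with a monotone normalisation of `τ`.** From the fact one may take the polynomial
`τ` with `τ(m) ≥ m` (indeed `≥ m + 1`) for all `m` — replace `τ` by `τ + X + 1`, which only shrinks
the no-part (`gapKvsK_no_anti`) —, so that `Gap_τ(K vs K)` is disjoint (`gapKvsK_disjoint`).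
[Hirahara 2021 (ECCC TR21-058), Lemma 5.1, Def. 2.5] [cite: Hirahara2021, Lemma 5.1] -/
theorem Hirahara2021_gapKvsK_mem_PromiseP.exists_ge (h : Hirahara2021_gapKvsK_mem_PromiseP)
    (U : UniversalMachine)
    (hyp : ∃ c : ℕ, distClass coNP {uniformEnsemble, tallyEnsemble} ⊆
      Avg1DeltaP fun n => 1 - 1 / (n : ℝ) ^ c) :
    ∃ τ : Polynomial ℕ, (∀ m, m + 1 ≤ τ.eval m) ∧ U.gapKvsK (fun m => τ.eval m) ∈ PromiseP := by
  obtain ⟨τ, hτ⟩ := h U hyp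
  refine ⟨τ + Polynomial.X + 1, fun m => ?_, mem_PromiseP_of_no_subset hτ le_rfl
    (U.gapKvsK_no_anti fun m => ?_)⟩
  · simp only [Polynomial.eval_add, Polynomial.eval_X, Polynomial.eval_one]
    omega
  · simp only [Polynomial.eval_add, Polynomial.eval_X, Polynomial.eval_one]
    omega

/-! ### Def. 4.1: ensembles of languages -/

/-- The `t`-th **slice** `L_t := {x ∈ {0,1}* | (x, 1ᵗ) ∈ L}` of a language `L` of pairs
`(x, 1ᵗ) = paramEnc (x, t)`. [Hirahara 2021 (ECCC TR21-058), Def. 4.1] [cite: Hirahara2021, Def. 4.1] -/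
def languageSlice (L : Language Bool) (t : ℕ) : Set (List Bool) :=
  {x | paramEnc (x, t) ∈ L}

/-- Membership in a slice unfolds definitionally. [Hirahara 2021 (ECCC TR21-058), Def. 4.1]
[cite: Hirahara2021, Def. 4.1] -/
@[simp] theorem mem_languageSlice_iff {L : Language Bool} {t : ℕ} {x : List Bool} :
    x ∈ languageSlice L t ↔ paramEnc (x, t) ∈ L :=
  Iff.rfl

/-- A language `L ⊆ {0,1}*` **is an ensemble of languages** `{L_t}_{t ∈ ℕ}` if for some polynomial
`p_L`, `|x| ≤ p_L(t)` for every `t` and every `x ∈ L_t`. [Hirahara 2021 (ECCC TR21-058), Def. 4.1]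
[cite: Hirahara2021, Def. 4.1] -/
def IsLanguageEnsemble (L : Language Bool) : Prop :=
  ∃ p : Polynomial ℕ, ∀ (t : ℕ) (x : List Bool), x ∈ languageSlice L t → x.length ≤ p.eval t

/-- Every slice of an ensemble of languages is finite (it consists of strings of length
`≤ p_L(t)`). [Hirahara 2021 (ECCC TR21-058), Def. 4.1] [cite: Hirahara2021, Def. 4.1] -/
theorem IsLanguageEnsemble.finite_languageSlice {L : Language Bool} (h : IsLanguageEnsemble L) (t : ℕ) :
    (languageSlice L t).Finite := by
  obtain ⟨p, hp⟩ := h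
  exact (List.finite_length_le Bool (p.eval t)).subset fun x hx => hp t x hx

namespace UniversalMachine

variable (U : UniversalMachine)

/-- **The promise problem of Thm. 4.2** for a language `L` of pairs (an ensemble `{L_t}`) and a
time/size polynomial `p`: `Π_Yes := {(x, 1ᵗ) | x ∈ L_t} (= L` on well-formed pairs`)` and
`Π_No := {(x, 1ᵗ) | K^{p(t)}(x) > log |L_t| + log p(t)}`, with `log = Nat.log 2`, `|L_t|` the
cardinality `Set.ncard` of the slice (finite for an ensemble; for `|L_t| = 0` the printed no-slice
is everything, Remark 4.3, of which ours is a subset). [Hirahara 2021 (ECCC TR21-058), Thm. 4.2,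
Remark 4.3] [cite: Hirahara2021, Thm. 4.2] -/
def compressionProblem (L : Language Bool) (p : ℕ → ℕ) : PromiseProblem :=
  ⟨{w | ∃ (x : List Bool) (t : ℕ), w = paramEnc (x, t) ∧ x ∈ languageSlice L t},
    {w | ∃ (x : List Bool) (t : ℕ), w = paramEnc (x, t) ∧
      ((Nat.log 2 (languageSlice L t).ncard + Nat.log 2 (p t) : ℕ) : ℕ∞) < U.ktAt (p t) x}⟩

/-- A pair `(x, 1ᵗ)` is a yes-instance of the compression problem iff `x ∈ L_t`.
[Hirahara 2021 (ECCC TR21-058), Thm. 4.2] [cite: Hirahara2021, Thm. 4.2] -/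
theorem paramEnc_mem_compressionProblem_yes_iff (L : Language Bool) (p : ℕ → ℕ) {x : List Bool} {t : ℕ} :
    paramEnc (x, t) ∈ (U.compressionProblem L p).yes ↔ x ∈ languageSlice L t := by
  constructor
  · rintro ⟨x', t', h, hx⟩
    have h1 := boolPair_injective (a₁ := (x, _)) (a₂ := (x', _)) h
    simp only [Prod.mk.injEq] at h1
    obtain ⟨rfl, h2⟩ := h1
    have ht : t = t' := by simpa using congr_arg unaryDecodeNat h2
    subst ht
    exact hx
  · exact fun h => ⟨x, t, rfl, h⟩

/-- A pair `(x, 1ᵗ)` is a no-instance of the compression problem iff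
`log |L_t| + log p(t) < K^{p(t)}(x)`. [Hirahara 2021 (ECCC TR21-058), Thm. 4.2]
[cite: Hirahara2021, Thm. 4.2] -/
theorem paramEnc_mem_compressionProblem_no_iff (L : Language Bool) (p : ℕ → ℕ) {x : List Bool} {t : ℕ} :
    paramEnc (x, t) ∈ (U.compressionProblem L p).no ↔
      ((Nat.log 2 (languageSlice L t).ncard + Nat.log 2 (p t) : ℕ) : ℕ∞) < U.ktAt (p t) x := by
  constructor
  · rintro ⟨x', t', h, hx⟩
    have h1 := boolPair_injective (a₁ := (x, _)) (a₂ := (x', _)) h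
    simp only [Prod.mk.injEq] at h1
    obtain ⟨rfl, h2⟩ := h1
    have ht : t = t' := by simpa using congr_arg unaryDecodeNat h2
    subst ht
    exact hx
  · exact fun h => ⟨x, t, rfl, h⟩

/-- Enlarging the polynomial shrinks the no-part of the compression problem (`K^{p'}` ≤ `K^{p}`,
`log p ≤ log p'`). [Hirahara 2021 (ECCC TR21-058), Thm. 4.2] [cite: Hirahara2021, Thm. 4.2] -/
theorem compressionProblem_no_anti (L : Language Bool) {p p' : ℕ → ℕ} (h : ∀ t, p t ≤ p' t) :
    (U.compressionProblem L p').no ≤ (U.compressionProblem L p).no := by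
  rintro w ⟨x, t, rfl, hk⟩
  refine ⟨x, t, rfl, lt_of_le_of_lt ?_ (hk.trans_le (U.ktAt_anti (h t) x))⟩
  exact_mod_cast Nat.add_le_add_left (Nat.log_mono_right (h t)) _

end UniversalMachine

/-! ### Thm. 4.2 (named fact) and Cor. 4.4 (proved from it) -/

/-- **Hirahara 2021, Thm. 4.2 (algorithmic language compression)** (for the empty oracle).
*Let `A` be an oracle and `L = {L_t}_{t ∈ ℕ} ∈ NP^A` be an ensemble of languages. Assume that
`coNP^A × {U, T} ⊆ Avg¹_{1-n^{-c}} P` for some constant `c`. Then there exists a polynomial `p` such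
that the promise problem `Π = (Π_Yes, Π_No)` defined as `Π_Yes := {(x, 1ᵗ) | x ∈ L_t} = L`,
`Π_No := {(x, 1ᵗ) | K^{p(t)}(x) > log |L_t| + log p(t)}` is in `pr-P`.* Vendored with `A = ∅`
(`L ∈ NP`, hypothesis on `coNP`), `∀ U : UniversalMachine`, the promise problem being
`U.compressionProblem L p` (well-formed pairs of `L` as yes-part; `Nat.log 2`, see the module
docstring for the equivalence up to `p ↦ 4p`). Printed proof: Lemma 4.5 (estimating `|L_t|` by the
Goldwasser–Sipser lower bound protocol on unary inputs, Lemma 4.6, derandomised by Lemma 3.4 and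
Lemma 3.6), the `k`-wise direct product generator and its reconstruction (Thm. 3.12), Claim 4.7.
[Hirahara 2021 (ECCC TR21-058), Thm. 4.2 with Def. 4.1] [cite: Hirahara2021, Thm. 4.2] -/
def Hirahara2021_languageCompression : Prop :=
  ∀ U : UniversalMachine,
    (∃ c : ℕ, distClass coNP {uniformEnsemble, tallyEnsemble} ⊆
      Avg1DeltaP fun n => 1 - 1 / (n : ℝ) ^ c) →
    ∀ L : Language Bool, L ∈ NP → IsLanguageEnsemble L →
      ∃ p : Polynomial ℕ, U.compressionProblem L (fun t => p.eval t) ∈ PromiseP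

/-- **Hirahara 2021, Cor. 4.4 (language compression)**, proved from Thm. 4.2 exactly as printed:
*under the same assumptions there exists a polynomial `p` such that
`K^{p(t)}(x) ≤ log |L_t| + log p(t)` for every `t ∈ ℕ` and every `x ∈ L_t`* — for `x ∈ L_t` the
pair `(x, 1ᵗ)` is a yes-instance, and a promise problem in `pr-P` has disjoint yes- and no-parts,
so `(x, 1ᵗ) ∉ Π_No`. [Hirahara 2021 (ECCC TR21-058), Cor. 4.4] [cite: Hirahara2021, Cor. 4.4] -/
theorem Hirahara2021_languageCompression.ktAt_le (h : Hirahara2021_languageCompression)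
    (U : UniversalMachine)
    (hyp : ∃ c : ℕ, distClass coNP {uniformEnsemble, tallyEnsemble} ⊆
      Avg1DeltaP fun n => 1 - 1 / (n : ℝ) ^ c)
    {L : Language Bool} (hL : L ∈ NP) (hens : IsLanguageEnsemble L) :
    ∃ p : Polynomial ℕ, ∀ (t : ℕ) (x : List Bool), x ∈ languageSlice L t →
      U.ktAt (p.eval t) x ≤ ((Nat.log 2 (languageSlice L t).ncard + Nat.log 2 (p.eval t) : ℕ) : ℕ∞) := by
  obtain ⟨p, hp⟩ := h U hyp L hL hens
  refine ⟨p, fun t x hx => ?_⟩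
  have hdis := PromiseProblem.Disjoint.of_mem_promiseLift hp
  have hyes : paramEnc (x, t) ∈ (U.compressionProblem L fun t => p.eval t).yes :=
    (U.paramEnc_mem_compressionProblem_yes_iff L _).2 hx
  by_contra hlt
  push Not at hlt
  have hno : paramEnc (x, t) ∈ (U.compressionProblem L fun t => p.eval t).no :=
    (U.paramEnc_mem_compressionProblem_no_iff L _).2 hlt
  exact Set.disjoint_left.1 hdis hyes hno

end Literature.Computability.MetaComplexity
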